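import Summits.MatrixMultiplication.OmegaCensus.BoxUsefulAtomConfig
import Summits.MatrixMultiplication.OmegaCensus.BoxUsefulCoordQuot
import Summits.MatrixMultiplication.OmegaCensus.BoxRatioSectionLawSolvable

/-!
# ω-census, family (b3): conjecture C9 (b) for every finite solvable group, modulo the Schmidt atoms

HONEST FRAMING (pub-omega census; verbatim): lottery ticket; floor = certified bounds/negative ranges.
Census BOOKKEEPING (conjecture C9 of the cell, STRUCTURE.md §2, `BoxRatioSectionLaw`; pub-omega kernel-l4 gen 17, task K-5″ —
structure side for all primes).  Nothing here is progress on `ω`.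

THE ATOM HYPOTHESIS.  `AtomBad p q` (`BoxUsefulAtomConfig`) says: every finite group carrying the relation-form configuration
`AtomConfig p q a y` is not box-useful.  For distinct primes this is the statement «the Schmidt atom `A(p,q) = 𝔽_{p^k} ⋊ μ_q`
(and hence every Frobenius group `𝔽_p^m ⋊ C_q`) is not box-useful», phrased without choosing a model; it is the cell's
stpp-1 side of task K-5 (in the tree for `q = 3`, all `p`, as concrete models; `(2,3) = A₄` in relation form,
`atomBad_two_three`; `q = 2`, `p ≥ 5` = the dihedral groups `D_{2p}`, concrete models in `DihedralClassification`).

**Theorem (`boxRatioSectionLaw_of_isSolvable_of_atomBad`).**  Assume `AtomBad p q` for all distinct primes `p, q` with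
`max(p,q) ≥ 5`.  Then every finite solvable box-useful group `G` satisfies C9 (b): `[G : Z(G)] ∈ {1, 4, 6}` or `G ∈ 𝒞₂`.
**Corollary (`boxRatioSectionLaw_of_atomBad_of_nonsolvable`).**  If moreover no non-solvable finite group is box-useful, then
`BoxRatioSectionLaw` holds outright.  (For `{2,3}`-groups the second hypothesis is Burnside's `p^a q^b` theorem, not in Mathlib.)

PROOF (induction on `|G|`).  `Z(G) ≠ 1`: the law lifts from `G/Z(G)` (`CentreLift.lawful_of_law_on_quotient`, prime-free).
`Z(G) = 1`, `G ≠ 1`: it suffices to show that `G` is a `{2,3}`-group, for then gen 16's `boxRatioSectionLaw_of_isSolvable`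
applies.  Let `r ≥ 5` be a prime dividing `|G|`, and `V` a minimal normal subgroup (an elementary abelian `p`-group, solvability).
If `p = r`, `exists_atomConfig_of_normal` produces an `AtomConfig r q a y` in `G` with `q ≠ r` prime — excluded by `AtomBad r q`.
If `p ≠ r`: every `z` with `z^r = 1` centralises `V` (else the trace lemma gives an `AtomConfig p r`); `C = C_G(V)` is a proper
subgroup (as `V ⊄ Z(G) = 1`), lawful by induction, and in a lawful group elements of prime order `≥ 5` are central
(`mem_center_of_lawful`); so `T = {z ∈ C : z^r = 1}` is a non-trivial normal elementary abelian `r`-subgroup of `G`, and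
`exists_atomConfig_of_normal` applied to `T` yields an `AtomConfig r q'`, excluded again.  Hence no such `r`.
-/

namespace Summit.MatrixMultiplication.OmegaCensus

universe u

namespace AtomReduction

/-- **In a lawful group, elements of prime order `r ≥ 5` are central**: if `[H : Z(H)] ∈ {1,4,6}` the image of `z` in
`H/Z(H)` has order dividing `gcd(r, [H:Z(H)]) = 1`; in the class `𝒞₂` an element of odd order prime to `3` has sign `+1` and
coordinates `0`, hence is central (`CoordLift.central_of_eps_one_of_coprime`). [folklore] -/
theorem mem_center_of_lawful {H : Type*} [Group H] [Finite H]
    (hlaw : (Subgroup.center H).index = 1 ∨ (Subgroup.center H).index = 4 ∨ (Subgroup.center H).index = 6 ∨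
      ∃ (c₁ c₂ : H) (κ₁ κ₂ ε : H → ZMod 3), DihC3Sq.Coord2 c₁ c₂ κ₁ κ₂ ε)
    {r : ℕ} (hr : r.Prime) (hr5 : 5 ≤ r) {z : H} (hz : z ^ r = 1) : z ∈ Subgroup.center H := by
  have hro : orderOf z ∣ r := orderOf_dvd_of_pow_eq_one hz
  have hr2 : ¬ r ∣ 2 := fun hd => by have := (Nat.prime_dvd_prime_iff_eq hr Nat.prime_two).1 hd; omega
  have hr3 : ¬ r ∣ 3 := fun hd => by have := (Nat.prime_dvd_prime_iff_eq hr Nat.prime_three).1 hd; omega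
  have hr1 : ¬ r ∣ 1 := fun hd => by have := Nat.eq_one_of_dvd_one hd; omega
  have hr4 : ¬ r ∣ 4 := fun hd => by
    rcases (Nat.Prime.dvd_mul hr).1 (show r ∣ 2 * 2 from hd) with h | h <;> exact hr2 h
  have hr6 : ¬ r ∣ 6 := fun hd => by
    rcases (Nat.Prime.dvd_mul hr).1 (show r ∣ 2 * 3 from hd) with h | h
    · exact hr2 h
    · exact hr3 h
  have key : ∀ m : ℕ, (Subgroup.center H).index = m → ¬ r ∣ m → z ∈ Subgroup.center H := by
    intro m hm hrm
    have hcop : Nat.Coprime r m := (Nat.Prime.coprime_iff_not_dvd hr).2 hrm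
    have h1 : (QuotientGroup.mk z : H ⧸ Subgroup.center H) ^ r = 1 := by
      rw [← QuotientGroup.mk_pow, hz, QuotientGroup.mk_one]
    have h2 : (QuotientGroup.mk z : H ⧸ Subgroup.center H) ^ m = 1 := by
      rw [← hm, Subgroup.index_eq_card]; exact pow_card_eq_one'
    have h3 : (QuotientGroup.mk z : H ⧸ Subgroup.center H) ^ Nat.gcd r m = 1 := pow_gcd_eq_one.2 ⟨h1, h2⟩
    rw [Nat.Coprime.gcd_eq_one hcop, pow_one, QuotientGroup.eq_one_iff] at h3
    exact h3
  rcases hlaw with h1 | h4 | h6 | ⟨c₁, c₂, κ₁, κ₂, ε, h⟩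
  · exact key 1 h1 hr1
  · exact key 4 h4 hr4
  · exact key 6 h6 hr6
  · rw [Subgroup.mem_center_iff]
    intro g
    have hodd : Odd (orderOf z) := (hr.odd_of_ne_two (by omega)).of_dvd_nat hro
    have hcop : (orderOf z).Coprime 3 :=
      Nat.Coprime.coprime_dvd_left hro ((Nat.coprime_primes hr Nat.prime_three).2 (by omega))
    exact CoordLift.central_of_eps_one_of_coprime h (CoordLift.eps_eq_one_of_odd h hodd) hcop g

/-- **No prime `r ≥ 5` divides the order of a centreless solvable box-useful group whose proper subgroups are lawful**, given the
atom hypothesis for all pairs of distinct primes with maximum `≥ 5` (the heart of the induction; see the module docstring). [folklore] -/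
theorem false_of_prime_dvd_card {G : Type u} [Group G] [Fintype G] [DecidableEq G] [IsSolvable G]
    (hAtom : ∀ p q : ℕ, p.Prime → q.Prime → p ≠ q → (5 ≤ p ∨ 5 ≤ q) → AtomBad.{u} p q)
    (hG : BoxUseful G) (hZ : Subgroup.center G = ⊥) [Nontrivial G]
    (IH : ∀ (K : Subgroup G) [Fintype K], K ≠ ⊤ → BoxUseful K →
      (Subgroup.center K).index = 1 ∨ (Subgroup.center K).index = 4 ∨ (Subgroup.center K).index = 6 ∨
        ∃ (c₁ c₂ : K) (κ₁ κ₂ ε : K → ZMod 3), DihC3Sq.Coord2 c₁ c₂ κ₁ κ₂ ε)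
    {r : ℕ} (hr : r.Prime) (hr5 : 5 ≤ r) (hrd : r ∣ Fintype.card G) : False := by
  classical
  have hVZ : ∀ v : G, (∀ g : G, g * v = v * g) → v = 1 := by
    intro v hv
    have : v ∈ Subgroup.center G := Subgroup.mem_center_iff.2 hv
    rwa [hZ, Subgroup.mem_bot] at this
  obtain ⟨V, hVn, hV1, -, hVab, p, hp, -, hVp⟩ := Endgame.exists_minimal_normal G
  haveI := hVn
  by_cases hpr : p = r
  · -- `V` is an `r`-group: the configuration sits on `V` itself
    subst hpr
    obtain ⟨q, a, y, hq, hqp, -, hconf⟩ := exists_atomConfig_of_normal hp V hVab hVp hV1 (fun v _ hv => hVZ v hv)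
    exact hAtom p q hp hq (Ne.symm hqp) (Or.inl hr5) G a y hconf hG
  · -- `p ≠ r`: every `z` with `z^r = 1` centralises `V`
    have hzC : ∀ z : G, z ^ r = 1 → ∀ v ∈ V, z * v * z⁻¹ = v := by
      intro z hz
      by_contra hcon
      push Not at hcon
      obtain ⟨a, -, hconf⟩ := exists_atomConfig (p := p) (q := r) hVab hVp (fun v hv => hVn.conj_mem v hv z) hcon
        (fun v _ => by rw [hz]; simp)
      exact hAtom p r hp hr hpr (Or.inr hr5) G a z hconf hG
    -- the centraliser `C = C_G(V)`, a proper subgroup, lawful by induction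
    haveI hCn : (Subgroup.centralizer (V : Set G)).Normal := inferInstance
    set C := Subgroup.centralizer (V : Set G) with hCdef
    have hC : ∀ g : G, g ∈ C ↔ ∀ v ∈ V, g * v * g⁻¹ = v := by
      intro g
      rw [hCdef, Subgroup.mem_centralizer_iff]
      refine ⟨fun h v hv => ?_, fun h v hv => ?_⟩
      · rw [mul_inv_eq_iff_eq_mul, h v hv]
      · exact (mul_inv_eq_iff_eq_mul.1 (h v hv)).symm
    have hCtop : C ≠ ⊤ := by
      intro htop
      obtain ⟨v, hvV, hv1⟩ : ∃ v ∈ V, v ≠ (1 : G) := by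
        by_contra! h
        exact hV1 ((Subgroup.eq_bot_iff_forall _).2 h)
      refine hv1 (hVZ v fun g => ?_)
      have hg : g ∈ C := by rw [htop]; exact Subgroup.mem_top g
      exact mul_inv_eq_iff_eq_mul.1 ((hC g).1 hg v hvV)
    have hClaw := IH C hCtop (hG.subgroup C)
    -- elements `z ∈ C` with `z^r = 1` are central in `C`
    have hzZ : ∀ z : G, z ^ r = 1 → ∀ c ∈ C, c * z = z * c := by
      intro z hz c hc
      have hzC' : z ∈ C := (hC z).2 (hzC z hz)
      have hz' : (⟨z, hzC'⟩ : C) ^ r = 1 := Subtype.ext (by simp [hz])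
      have hmem := mem_center_of_lawful hClaw hr hr5 hz'
      rw [Subgroup.mem_center_iff] at hmem
      have := hmem ⟨c, hc⟩
      exact congrArg Subtype.val this
    -- `T = {z ∈ C : z^r = 1}`, a non-trivial normal elementary abelian `r`-subgroup of `G`
    let T : Subgroup G :=
      { carrier := {z | z ∈ C ∧ z ^ r = 1}
        one_mem' := ⟨C.one_mem, one_pow r⟩
        mul_mem' := fun {z w} hz hw => ⟨C.mul_mem hz.1 hw.1, by
          have hcomm : Commute z w := (hzZ z hz.2 w hw.1).symm
          rw [hcomm.mul_pow, hz.2, hw.2, one_mul]⟩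
        inv_mem' := fun {z} hz => ⟨C.inv_mem hz.1, by rw [inv_pow, hz.2, inv_one]⟩ }
    have hT : ∀ z : G, z ∈ T ↔ z ∈ C ∧ z ^ r = 1 := fun z => Iff.rfl
    haveI hTn : T.Normal := ⟨fun z hz g => (hT _).2 ⟨hCn.conj_mem z ((hT z).1 hz).1 g, by
      rw [CentreLift.conj_pow', ((hT z).1 hz).2]; group⟩⟩
    have hTab : ∀ z ∈ T, ∀ w ∈ T, z * w = w * z :=
      fun z hz w hw => (hzZ z ((hT z).1 hz).2 w ((hT w).1 hw).1).symm
    have hTr : ∀ z ∈ T, z ^ r = 1 := fun z hz => ((hT z).1 hz).2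
    have hT1 : T ≠ ⊥ := by
      haveI : Fact r.Prime := ⟨hr⟩
      obtain ⟨z₀, hz₀⟩ := exists_prime_orderOf_dvd_card r hrd
      have hz₀r : z₀ ^ r = 1 := by rw [← hz₀, pow_orderOf_eq_one]
      have hz₀T : z₀ ∈ T := (hT z₀).2 ⟨(hC z₀).2 (hzC z₀ hz₀r), hz₀r⟩
      intro hbot
      rw [hbot, Subgroup.mem_bot] at hz₀T
      rw [hz₀T, orderOf_one] at hz₀
      exact hr.one_lt.ne hz₀
    obtain ⟨q, a, y, hq, hqr, -, hconf⟩ := exists_atomConfig_of_normal hr T hTab hTr hT1 (fun v _ hv => hVZ v hv)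
    exact hAtom r q hr hq (Ne.symm hqr) (Or.inl hr5) G a y hconf hG

/-- **C9 (b) for finite solvable groups, modulo the atoms** (induction on the order). [folklore] -/
theorem lawful_of_isSolvable_of_atomBad_aux
    (hAtom : ∀ p q : ℕ, p.Prime → q.Prime → p ≠ q → (5 ≤ p ∨ 5 ≤ q) → AtomBad.{u} p q) (n : ℕ) :
    ∀ (G : Type u) [Group G] [Fintype G] [DecidableEq G] [IsSolvable G],
    Fintype.card G = n → BoxUseful G →
      (Subgroup.center G).index = 1 ∨ (Subgroup.center G).index = 4 ∨ (Subgroup.center G).index = 6 ∨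
        ∃ (c₁ c₂ : G) (κ₁ κ₂ ε : G → ZMod 3), DihC3Sq.Coord2 c₁ c₂ κ₁ κ₂ ε := by
  induction n using Nat.strong_induction_on with
  | _ n IH =>
  intro G _ _ _ _ hn hG
  classical
  by_cases hZ : Subgroup.center G = ⊥
  swap
  · -- non-trivial centre: the law lifts from `G / Z(G)`
    apply CentreLift.lawful_of_law_on_quotient hG
    intro hq
    have hlt : Fintype.card (G ⧸ Subgroup.center G) < n := by
      rw [← hn, ← Nat.card_eq_fintype_card, ← Nat.card_eq_fintype_card,
        Subgroup.card_eq_card_quotient_mul_card_subgroup (Subgroup.center G)]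
      exact lt_mul_of_one_lt_right Nat.card_pos ((Subgroup.center G).one_lt_card_iff_ne_bot.2 hZ)
    exact IH _ hlt (G ⧸ Subgroup.center G) rfl hq
  · by_cases htriv : Nontrivial G
    swap
    · -- the trivial group
      left
      haveI : Subsingleton G := not_nontrivial_iff_subsingleton.1 htriv
      rw [Subgroup.index_eq_one, eq_top_iff]
      intro x _
      rw [Subgroup.mem_center_iff]
      intro g
      rw [Subsingleton.elim x 1, mul_one, one_mul]
    · -- centreless and non-trivial: `G` is a `{2,3}`-group, then gen 16's theorem
      have IH' : ∀ (K : Subgroup G) [Fintype K], K ≠ ⊤ → BoxUseful K →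
          (Subgroup.center K).index = 1 ∨ (Subgroup.center K).index = 4 ∨ (Subgroup.center K).index = 6 ∨
            ∃ (c₁ c₂ : K) (κ₁ κ₂ ε : K → ZMod 3), DihC3Sq.Coord2 c₁ c₂ κ₁ κ₂ ε := by
        intro K _ hK hKu
        have hlt : Fintype.card K < n := by
          rw [← hn, ← Nat.card_eq_fintype_card, ← Nat.card_eq_fintype_card, ← K.card_mul_index]
          exact lt_mul_of_one_lt_right Nat.card_pos (Subgroup.one_lt_index_of_ne_top hK)
        exact IH _ hlt K rfl hKu
      have h23 : ∀ r : ℕ, r.Prime → r ∣ Fintype.card G → r = 2 ∨ r = 3 := by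
        intro r hr hrd
        by_contra hne
        push Not at hne
        exact false_of_prime_dvd_card hAtom hG hZ IH' hr (hr.five_le_of_ne_two_of_ne_three hne.1 hne.2) hrd
      exact boxRatioSectionLaw_of_isSolvable G h23 hG

end AtomReduction

/-- **Conjecture C9 (b) (`BoxRatioSectionLaw`) holds for every finite solvable group, modulo the Schmidt atoms**: if every
finite group carrying a configuration `AtomConfig p q` (`p ≠ q` primes, `max(p,q) ≥ 5`) is box-useless, then a box-useful
finite solvable group has centre of index `1`, `4` or `6`, or lies in the class `𝒞₂`. [folklore] -/
theorem boxRatioSectionLaw_of_isSolvable_of_atomBad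
    (hAtom : ∀ p q : ℕ, p.Prime → q.Prime → p ≠ q → (5 ≤ p ∨ 5 ≤ q) → AtomBad.{u} p q)
    (G : Type u) [Group G] [Fintype G] [DecidableEq G] [IsSolvable G] (hG : BoxUseful G) :
    (Subgroup.center G).index = 1 ∨ (Subgroup.center G).index = 4 ∨ (Subgroup.center G).index = 6 ∨
      ∃ (c₁ c₂ : G) (κ₁ κ₂ ε : G → ZMod 3), DihC3Sq.Coord2 c₁ c₂ κ₁ κ₂ ε :=
  AtomReduction.lawful_of_isSolvable_of_atomBad_aux hAtom (Fintype.card G) G rfl hG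

/-- **`BoxRatioSectionLaw` modulo the atoms and the non-solvable groups**: if the atoms `A(p,q)` with `max(p,q) ≥ 5` are
box-useless (relation form) and no non-solvable finite group is box-useful, then conjecture C9 (b) holds. [folklore] -/
theorem boxRatioSectionLaw_of_atomBad_of_nonsolvable
    (hAtom : ∀ p q : ℕ, p.Prime → q.Prime → p ≠ q → (5 ≤ p ∨ 5 ≤ q) → AtomBad.{0} p q)
    (hNS : ∀ (H : Type) [Group H] [Fintype H] [DecidableEq H], ¬ IsSolvable H → ¬ BoxUseful H) :
    BoxRatioSectionLaw := by
  intro G _ _ _ hG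
  by_cases hs : IsSolvable G
  · exact boxRatioSectionLaw_of_isSolvable_of_atomBad hAtom G hG
  · exact absurd hG (hNS G hs)

end Summit.MatrixMultiplication.OmegaCensus
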